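import Summits.QuantumFields.YangMills.Theorems.BalabanUVNodesN15FullPropagatorV1GTwoSidedNode
import Summits.QuantumFields.YangMills.Theorems.BalabanUVNodesN15BackgroundV1ExactLetters
import HarnessLib

/-!
# `T4EtaRate.NE2PlusOperator` BY NAME FOR BAŁABAN's FULL `U ≡ 1` PROPAGATOR ⊗ 1_𝔤 ON THE TORUS FAMILY DRESSED BY THE EXACT `V′₁(A)` OF (3.50)–(3.53) — FILE 27's twin with the EXACT
# coefficients `(v1coefCX, v1coefAX)` of FILE 28 (backward `F′`-argument negated as (3.50) demands); by FILE 31 the dressed propagator of THIS family IS the Green's function of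
# `Δ_{e^{ηA}} + (aQ*Q − ∂P∂*)(1) ⊗ 1_𝔤` (dag-n15-c g10, FILE 30; Track-A node N15 = NE2, s1 «background-layer OPERATOR ingredient»)

`--kind definition --supports stmt-QuantumFields-20544 --as helper` (K3⁷; count-neutral).  Imports BY NAME this seat's FILE 27 `…FullPropagatorV1GTwoSidedNode` (`fgInstanceV1G` — the SAME
paired instance: carriers `v1GaugeBg`, block-mean pairing `v1GaugePairing`; ★★ `uniform_layer_fullGM₂R`; through it FILE 24 ★★★ `ne2PlusOperator_twoSided_of_letters`, `bgFamilyM₂R`, FILE 21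
`dPiecesM₂`, FILE 26 `gaugeLetters_of_mean`, g1 `gavgM`, g2 `v1fieldsOfGauge`, the torus laws) and FILE 29b `…BackgroundV1ExactLetters` (★★ `twoSidedLettersX_of_gauge`; through it FILE 28
`v1coefCX` ∕ `v1coefAX`); nothing in the tree is modified.

WHAT.  §1 `v1cfgFX`, `v1cfgCX` (defs: the EXACT coefficient readings at the fine spacing and at the coarse spacing of the BLOCK-MEAN field), `fgFamilyV1X` (def: FILE 24's `bgFamilyM₂R` with
these readings on FILE 27's instance `fgInstanceV1G` and FILE 21's pieces), ★★★ `twoSidedLettersX_of_meanGauge` (FILE 26's ★★★ for the exact coefficients: the fifteen letters from the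
C² letters of ONE fine gauge field, coarse side READ FROM THE MEAN FIELD).  §2 ★★ `twoSidedLettersX_torus` (the fifteen exact letters on the torus family for every regular gauge field in the window — FILE 27's
internal step, now a citable lemma), ★★★ `ne2PlusOperator_fullGM₂_v1X_of_entry2`, ★★★ **`ne2PlusOperator_fullGM₂_v1X :
NE2PlusOperator c₃₅ (fgInstanceV1G d 𝔄 ι hL) (fgFamilyV1X d 𝔄 ι e hL b)`** (`γ = 1∕(8(d+1))`, `d ≥ 1`, `L` odd `≥ 3`, hypothesis-free), `_dim4` — FILE 27 §3's proofs verbatim with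
the exact letters.

HONEST FRAMING.  As FILE 27: MODEL-LEVEL in the READING of (3.35)–(3.36) (unit-scale C² letters in one global gauge), `𝔤 ↦ 𝔄` with coordinates `e`, block MEAN as the background transport
(linearised (C3)), gauge-fixing `DRD*` and averaging `aQ*Q` at `U ≡ 1` (not dressed); GENUINE: the propagator, the covariant Laplacian at `U′ = e^{iηA′}` EXACTLY (FILE 28 (3.53) + FILE 31),
both bond orientations, entry 2 by parts.  NE2⁺ as printed NOT PRINTED, not claimed; count-neutral; N15 NOT discharged; one finite torus at fixed ε — NOT ℝ⁴, NOT infinite volume, NOT OS,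
NOT a mass gap, NOT Clay.
-/

noncomputable section

open scoped BigOperators
open Finset

namespace Summit.QuantumFields.YangMills.BalabanUVNodes.N15.BackgroundLayer

open Literature.MathematicalPhysics.QuantumFieldTheory.Balaban1983to89
open Literature.MathematicalPhysics.QuantumFieldTheory.Balaban1983to89.B11SectG (BlockNorm HasMaj RowSum)
open Literature.MathematicalPhysics.QuantumFieldTheory.Balaban1983to89.T4EtaRate (PairedInstance NE2PlusOperator rateFactor)
open Literature.MathematicalPhysics.QuantumFieldTheory.Balaban1983to89.T4EtaRateDefect (idef idef_apply rateWeight)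
open Literature.MathematicalPhysics.QuantumFieldTheory.Balaban1983to89.T4EtaRateCoeffDefect (pull pull_apply diagK diagK_nonneg)
open Literature.MathematicalPhysics.QuantumFieldTheory.Balaban1983to89.B5Prop11Plancherel (Tor fine unitVec)
open Literature.MathematicalPhysics.QuantumFieldTheory.Balaban1983to89.B5SiteBridgeP12 (MP)
open Literature.MathematicalPhysics.QuantumFieldTheory.Balaban1983to89.B6UnitTorusCarrier (unitTorusGeo triangle254_unitTorusGeo rowSum_unitTorusGeo unitTorusGeo_dist_nonneg
  unitTorusGeo_len)
open Literature.MathematicalPhysics.QuantumFieldTheory.King1986.Torus (blockOf tdistT tdistT_nonneg tdistT_self)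
open Summit.QuantumFields.YangMills.BalabanUVNodes.N15.MatrixSpecies (mmulOp liftMap liftBlk liftEquiv liftEquiv_apply liftEquiv_symm_apply basisConst basisConst_nonneg)
open Summit.QuantumFields.YangMills.BalabanUVNodes.N15.TwoGrid (gOp symbOp sT sTinv sD sLap paramsOf hasMaj_rate_mono hasMaj_twoGridDefect_div TGIndex TGIndex.Mn)
open Summit.QuantumFields.YangMills.BalabanUVNodes.N15.VectorPiece (blkFine kingPrV blkFine_comp_kingPrV bshiftEquiv bshiftEquiv_apply bshiftEquiv_symm_apply bshiftV bshiftV_apply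
  tensorId tensorId_apply hasMaj_tensorId idef_tensorId kingPrV_bshiftEquiv_pow fibre_conn_kingPrV bshiftEquiv_comm inv_pow_le_rpow)

variable {d : ℕ} {L : ℕ} [NeZero L]

/-! ## §1 The coefficient readings and the realised gauge-dressed family -/

section Family

variable (d) (𝔄 : Type) [NormedRing 𝔄] [NormedAlgebra ℝ 𝔄] [CompleteSpace 𝔄] (ι : Type) [Fintype ι] [DecidableEq ι] (e : 𝔄 ≃L[ℝ] (ι → ℝ))

/-- THE FINE COEFFICIENT READING: `A′ ↦ (c′, a′)`, the coefficients of `V′₁` (g2 V1a) at the derived triple `v1fieldsOfGauge s′ η′ A′ = (A′, A′∘s′⁻¹, ∇′*A′)`.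
[cite: Balaban1985BackgroundPropagators, (3.52) p.400 (shape)] -/
def v1cfgFX {X' J : Type} [Fintype J] (s' : J → X' ≃ X') (η' : ℝ) (A' : J → X' → 𝔄) : (X' → Matrix ι ι ℝ) × (J ⊕ J → X' → Matrix ι ι ℝ) :=
  (v1coefCX e η' (v1fieldsOfGauge 𝔄 J s' η' A'), v1coefAX e η' (v1fieldsOfGauge 𝔄 J s' η' A'))

/-- THE COARSE COEFFICIENT READING: `A′ ↦ (c, a)` at the derived triple OF THE BLOCK-MEAN FIELD `Ā = gavgM π A′` with the coarse shifts and spacing.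
[cite: Balaban1985BackgroundPropagators, (3.52) p.400 (shape); King1986, p.664 (pairing convention)] -/
def v1cfgCX {X X' J : Type} [Fintype J] [Fintype X'] [DecidableEq X] (π : X' → X) (s : J → X ≃ X) (η : ℝ) (A' : J → X' → 𝔄) :
    (X → Matrix ι ι ℝ) × (J ⊕ J → X → Matrix ι ι ℝ) :=
  (v1coefCX e η (v1fieldsOfGauge 𝔄 J s η (gavgM 𝔄 J π A')), v1coefAX e η (v1fieldsOfGauge 𝔄 J s η (gavgM 𝔄 J π A')))

/-- THE REALISED GAUGE-DRESSED TWO-SIDED BY-PARTS KERNEL FAMILY at `(i, ν)`: FILE 24's `bgFamilyM₂R` with the readings `v1cfgFX` (fine) ∕ `v1cfgCX` (coarse, at the block mean), pieces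
`G = gOp ⊗ 1_ι`, `dPiecesM₂` (forward AND backward), `D₃ = (ΔG) ⊗ 1_ι` at both spacings — all four (3.42) entries CONSTRUCTED, entry 2 BY PARTS, Bałaban's OWN `V′₁(A)`.
[cite: Balaban1985BackgroundPropagators, (3.42) p.397 + (3.52) p.400 (shapes)] -/
def fgFamilyV1X (hL : Odd L ∧ 1 < L) (b : ℝ) (i : TGIndex × Fin (d + 1)) : B9.KernelFamily (fgInstanceV1G d 𝔄 ι hL i).gc (fgInstanceV1G d 𝔄 ι hL i).Bf :=
  bgFamilyM₂R (ι := ι) (g := unitTorusGeo L i.1.k (TGIndex.Mn d hL i.1)) (blkFine L i.1.k (TGIndex.Mn d hL i.1)) (kingPrV L i.1.k i.1.m (TGIndex.Mn d hL i.1)) i.1.m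
    (v1GaugeBg 𝔄 (Fin (d + 1)) (fun μ => bshiftEquiv (TGIndex.Mn d hL i.1) (L ^ i.1.k) μ) (unitTorusGeo L i.1.k (TGIndex.Mn d hL i.1)).eta (unitTorusGeo L i.1.k (TGIndex.Mn d hL i.1)).M)
    (v1GaugeBg 𝔄 (Fin (d + 1)) (fun μ => bshiftEquiv (TGIndex.Mn d hL i.1) (L ^ i.1.m * L ^ i.1.k) μ)
      ((unitTorusGeo L i.1.k (TGIndex.Mn d hL i.1)).eta * ((unitTorusGeo L i.1.k (TGIndex.Mn d hL i.1)).L ^ i.1.m)⁻¹) (unitTorusGeo L i.1.k (TGIndex.Mn d hL i.1)).M)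
    (v1GaugePairing 𝔄 (Fin (d + 1)) ι (g := unitTorusGeo L i.1.k (TGIndex.Mn d hL i.1)) (blkFine L i.1.k (TGIndex.Mn d hL i.1)) (kingPrV L i.1.k i.1.m (TGIndex.Mn d hL i.1)) (fun μ => bshiftEquiv (TGIndex.Mn d hL i.1) (L ^ i.1.k) μ)
      (fun μ => bshiftEquiv (TGIndex.Mn d hL i.1) (L ^ i.1.m * L ^ i.1.k) μ) i.1.m (Nat.cast_ne_zero.mpr (NeZero.ne L)))
    (v1cfgFX 𝔄 ι e (fun μ => bshiftEquiv (TGIndex.Mn d hL i.1) (L ^ i.1.m * L ^ i.1.k) μ)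
      ((unitTorusGeo L i.1.k (TGIndex.Mn d hL i.1)).eta * ((unitTorusGeo L i.1.k (TGIndex.Mn d hL i.1)).L ^ i.1.m)⁻¹))
    (v1cfgCX 𝔄 ι e (kingPrV L i.1.k i.1.m (TGIndex.Mn d hL i.1)) (fun μ => bshiftEquiv (TGIndex.Mn d hL i.1) (L ^ i.1.k) μ) (unitTorusGeo L i.1.k (TGIndex.Mn d hL i.1)).eta)
    (fun μ => bshiftEquiv (TGIndex.Mn d hL i.1) (L ^ i.1.k) μ) (fun μ => bshiftEquiv (TGIndex.Mn d hL i.1) (L ^ i.1.m * L ^ i.1.k) μ) ((L ^ i.1.k : ℕ) : ℝ) ((L ^ i.1.m * L ^ i.1.k : ℕ) : ℝ) i.2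
    (tensorId ι (gOp (TGIndex.Mn d hL i.1) (L ^ i.1.k) b))
    (tensorId ι (symbOp (TGIndex.Mn d hL i.1) (L ^ i.1.k) (sLap (TGIndex.Mn d hL i.1) (L ^ i.1.k) ((L ^ i.1.k : ℕ) : ℝ)) ∘ₗ gOp (TGIndex.Mn d hL i.1) (L ^ i.1.k) b))
    (dPiecesM₂ d ι (TGIndex.Mn d hL i.1) (L ^ i.1.k) b)
    (tensorId ι (gOp (TGIndex.Mn d hL i.1) (L ^ i.1.m * L ^ i.1.k) b))
    (tensorId ι (symbOp (TGIndex.Mn d hL i.1) (L ^ i.1.m * L ^ i.1.k) (sLap (TGIndex.Mn d hL i.1) (L ^ i.1.m * L ^ i.1.k) ((L ^ i.1.m * L ^ i.1.k : ℕ) : ℝ)) ∘ₗ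
      gOp (TGIndex.Mn d hL i.1) (L ^ i.1.m * L ^ i.1.k) b))
    (dPiecesM₂ d ι (TGIndex.Mn d hL i.1) (L ^ i.1.m * L ^ i.1.k) b)


end Family

/-! ## §1b The fifteen exact letters from the C² letters of one fine gauge field (coarse side = block mean) -/

section Mean

variable {X X' J ι : Type} [Fintype X'] [DecidableEq X] [Fintype J] [Fintype ι] [DecidableEq ι] {𝔄 : Type} [NormedRing 𝔄] [NormedAlgebra ℝ 𝔄] [CompleteSpace 𝔄]
  (e : 𝔄 ≃L[ℝ] (ι → ℝ))

/-- ★★★ **THE FIFTEEN `TwoSidedLetters` FOR BAŁABAN's SPECIES (3.52) OF A FINE GAUGE FIELD AND ITS BLOCK MEAN, FROM THE UNIT-SCALE C² LETTERS OF THE FINE FIELD.**  With `0 < η′`,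
`η = Nη′ > 0`, `η ≤ min(1, θ)`, `C_πη′ ≤ C₀θ` and the window `2(1+|J|)(3+C₀)r ≤ 1`: FILE 25 ★★ `twoSidedLettersX_of_gauge` at `r̂ = (3+C₀)r` fed with §2.
[cite: Balaban1985BackgroundPropagators, (3.35)–(3.36) p.396, (3.52) p.400 (shapes); King1986, p.664] -/
theorem twoSidedLettersX_of_meanGauge {π : X' → X} {s : J → X ≃ X} {s' : J → X' ≃ X'} {N : ℕ} {η η' r θ Cπ C₀ : ℝ}
    (hcomm : ∀ μ κ x, (s' μ).symm (s' κ x) = s' κ ((s' μ).symm x))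
    (hconn : ∀ (f : X' → 𝔄) (β : ℝ), (∀ κ x, ‖f (s' κ x) - f x‖ ≤ β) → ∀ x₁ x₂, π x₁ = π x₂ → ‖f x₁ - f x₂‖ ≤ Cπ * β)
    (hblk : ∀ μ x', π ((s' μ ^ N) x') = s μ (π x')) (hη' : 0 < η') (hN : η = N * η') (hη : 0 < η) (hη1 : η ≤ 1) (hηθ : η ≤ θ) (hC₀ : 0 ≤ C₀)
    (hCθ : Cπ * η' ≤ C₀ * θ) (hr : 0 ≤ r) (hr2 : 2 * ((1 + Fintype.card J) * ((3 + C₀) * r)) ≤ 1) {A' : J → X' → 𝔄}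
    (h1 : ∀ μ x', ‖A' μ x'‖ ≤ r) (h2 : ∀ μ κ x', ‖A' μ (s' κ x') - A' μ x'‖ ≤ r * η')
    (h3 : ∀ μ κ x', ‖(A' μ (s' κ x') - A' μ x') - (A' μ (s' κ ((s' μ).symm x')) - A' μ ((s' μ).symm x'))‖ ≤ r * η' * η') :
    TwoSidedLetters J ι π s s' η⁻¹ η'⁻¹ (14 * Real.exp 1 * (1 + Fintype.card J) * basisConst e * ((1 + Fintype.card J) * ((3 + C₀) * r))) θ
      (v1coefCX e η' (v1fieldsOfGauge 𝔄 J s' η' A'), v1coefAX e η' (v1fieldsOfGauge 𝔄 J s' η' A'))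
      (v1coefCX e η (v1fieldsOfGauge 𝔄 J s η (gavgM 𝔄 J π A')), v1coefAX e η (v1fieldsOfGauge 𝔄 J s η (gavgM 𝔄 J π A'))) := by
  obtain ⟨g1, g2', g2, g3, g4, g5⟩ := gaugeLetters_of_mean hcomm hconn hblk hη' hN hη hr h1 h2 h3
  have hNpos : (1 : ℝ) ≤ N := by
    rcases Nat.eq_zero_or_pos N with h0 | hpos
    · exfalso; rw [hN, h0] at hη; simp at hη
    · exact_mod_cast hpos
  have hη'η : η' ≤ η := by rw [hN]; nlinarith
  have hθ : 0 ≤ θ := hη.le.trans hηθ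
  set R : ℝ := (3 + C₀) * r with hR
  have hrR : r ≤ R := by rw [hR]; nlinarith
  have hR0 : 0 ≤ R := hr.trans hrR
  -- every fit inside `R·θ`: `rη ≤ rθ`, `rη′ ≤ rθ`, `C_π rη′ ≤ C₀ rθ`
  have hf1 : r * η ≤ r * θ := mul_le_mul_of_nonneg_left hηθ hr
  have hf2 : r * η' ≤ r * θ := mul_le_mul_of_nonneg_left (hη'η.trans hηθ) hr
  have hf3 : Cπ * (r * η') ≤ C₀ * (r * θ) := by
    calc Cπ * (r * η') = r * (Cπ * η') := by ring
      _ ≤ r * (C₀ * θ) := mul_le_mul_of_nonneg_left hCθ hr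
      _ = C₀ * (r * θ) := by ring
  have hRθ : r * θ + r * θ + C₀ * (r * θ) ≤ R * θ := by rw [hR]; nlinarith [mul_nonneg hr hθ]
  have hrθ0 : 0 ≤ r * θ := mul_nonneg hr hθ
  exact twoSidedLettersX_of_gauge e hη' hη'η hη1 hηθ hR0 hr2 (fun μ x' => (h1 μ x').trans hrR) (fun μ x => (g1 μ x).trans hrR)
    (fun μ x' => (g2' μ x').trans (mul_le_mul_of_nonneg_right hrR hη'.le)) (fun μ x => (g2 μ x).trans (mul_le_mul_of_nonneg_right hrR hη.le))
    (fun μ x' => (g3 μ x').trans (by nlinarith [hf3])) (fun μ x' => (g4 μ x').trans (by nlinarith [hf1, hf2, hf3])) (fun μ x' => (g5 μ x').trans (by nlinarith [hf1, hf3]))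

end Mean

/-! ## §2 `NE2PlusOperator` by name for the exactly dressed family -/

section Node

variable (d) (𝔄 : Type) [NormedRing 𝔄] [NormedAlgebra ℝ 𝔄] [CompleteSpace 𝔄] (ι : Type) [Fintype ι] [DecidableEq ι] [Nonempty ι] (e : 𝔄 ≃L[ℝ] (ι → ℝ))

omit [Nonempty ι] in
/-- ★★ **THE FIFTEEN EXACT LETTERS ON THE TORUS FAMILY IN THE (3.35)-WINDOW**: for every index, every gauge field `A′` regular at `(c₃₅, α₀)` on the fine carrier and `c₃₅Mα₀` in the
window `r₀ = (2(2+d)(5+2d))⁻¹`, the readings `v1cfgFX A′` ∕ `v1cfgCX A′` obey `TwoSidedLetters` at scale `κ′·c₃₅Mα₀` (`κ′ = 14e(2+d)²(5+2d)(κ_e+1)`) and rate `(L^k)^{−γ}` (`γ ≤ 1`) —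
§1b ★★★ with the torus discharges of FILE 27 (`bshiftEquiv_comm`, `fibre_conn_kingPrV`, `kingPrV_bshiftEquiv_pow`, `η = L^{−k} = L^mη′ ≤ min(1, θ)`, `C_πη′ ≤ 2(d+1)θ`).
[cite: Balaban1985BackgroundPropagators, (3.35)–(3.36) p.396, (3.52) p.400 (shapes); King1986, p.664] -/
theorem twoSidedLettersX_torus (hL : Odd L ∧ 1 < L) (hL2 : 2 ≤ L) {γ : ℝ} (hγle1 : γ ≤ 1) {c35 : ℝ} (hc35 : 0 < c35) :
    ∀ (i : TGIndex × Fin (d + 1)) (A' : Fin (d + 1) → Tor (fine (L ^ i.1.m * L ^ i.1.k) (TGIndex.Mn d hL i.1)) × Fin (d + 1) → 𝔄) (α₀ : ℝ),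
      (v1GaugeBg 𝔄 (Fin (d + 1)) (fun μ => bshiftEquiv (TGIndex.Mn d hL i.1) (L ^ i.1.m * L ^ i.1.k) μ) ((unitTorusGeo L i.1.k (TGIndex.Mn d hL i.1)).eta * ((unitTorusGeo L i.1.k (TGIndex.Mn d hL i.1)).L ^ i.1.m)⁻¹) (unitTorusGeo L i.1.k (TGIndex.Mn d hL i.1)).M).Reg335 c35 α₀ A' → 0 < α₀ → 1 ≤ (unitTorusGeo L i.1.k (TGIndex.Mn d hL i.1)).M →
      c35 * (unitTorusGeo L i.1.k (TGIndex.Mn d hL i.1)).M * α₀ ≤ (2 * ((1 + Fintype.card (Fin (d + 1))) * (3 + 2 * ((d : ℝ) + 1))))⁻¹ →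
      TwoSidedLetters (Fin (d + 1)) ι (kingPrV L i.1.k i.1.m (TGIndex.Mn d hL i.1)) (fun μ => bshiftEquiv (TGIndex.Mn d hL i.1) (L ^ i.1.k) μ) (fun μ => bshiftEquiv (TGIndex.Mn d hL i.1) (L ^ i.1.m * L ^ i.1.k) μ) ((L ^ i.1.k : ℕ) : ℝ)
        ((L ^ i.1.m * L ^ i.1.k : ℕ) : ℝ) ((14 * Real.exp 1 * (1 + Fintype.card (Fin (d + 1))) * ((1 + Fintype.card (Fin (d + 1))) * (3 + 2 * ((d : ℝ) + 1))) * (basisConst e + 1)) * (c35 * (unitTorusGeo L i.1.k (TGIndex.Mn d hL i.1)).M * α₀)) (((L : ℝ) ^ i.1.k) ^ (-γ))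
        (v1cfgFX 𝔄 ι e (fun μ => bshiftEquiv (TGIndex.Mn d hL i.1) (L ^ i.1.m * L ^ i.1.k) μ) ((unitTorusGeo L i.1.k (TGIndex.Mn d hL i.1)).eta * ((unitTorusGeo L i.1.k (TGIndex.Mn d hL i.1)).L ^ i.1.m)⁻¹) A')
        (v1cfgCX 𝔄 ι e (kingPrV L i.1.k i.1.m (TGIndex.Mn d hL i.1)) (fun μ => bshiftEquiv (TGIndex.Mn d hL i.1) (L ^ i.1.k) μ) (unitTorusGeo L i.1.k (TGIndex.Mn d hL i.1)).eta A') := by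
  have hL0 : L ≠ 0 := by omega
  have hL1 : 1 ≤ L := by omega
  have hLr : (0 : ℝ) < (L : ℝ) := by exact_mod_cast (show 0 < L by omega)
  have hLr1 : (1 : ℝ) ≤ (L : ℝ) := by exact_mod_cast hL1
  have hdJ0 : (0 : ℝ) ≤ Fintype.card (Fin (d + 1)) := Nat.cast_nonneg _
  set C₀ : ℝ := 2 * ((d : ℝ) + 1) with hC₀
  have hC₀0 : 0 ≤ C₀ := by positivity
  set κ' : ℝ := 14 * Real.exp 1 * (1 + Fintype.card (Fin (d + 1))) * ((1 + Fintype.card (Fin (d + 1))) * (3 + C₀)) * (basisConst e + 1) with hκ'def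
  have hκe := basisConst_nonneg e
  have hκ'pos : 0 < κ' := by positivity
  set r₀ : ℝ := (2 * ((1 + Fintype.card (Fin (d + 1))) * (3 + C₀)))⁻¹ with hr₀def
  have hden : 0 < 2 * ((1 + Fintype.card (Fin (d + 1))) * (3 + C₀)) := by positivity
  intro i A' α₀ hreg hα₀ hM hwin
  obtain ⟨h1, h2', h3⟩ := hreg
  have hMeq : (unitTorusGeo L i.1.k (TGIndex.Mn d hL i.1)).M = 1 := rfl
  have hηc : (unitTorusGeo L i.1.k (TGIndex.Mn d hL i.1)).eta = ((L : ℝ) ^ i.1.k)⁻¹ := rfl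
  have hηf : (unitTorusGeo L i.1.k (TGIndex.Mn d hL i.1)).eta * ((unitTorusGeo L i.1.k (TGIndex.Mn d hL i.1)).L ^ i.1.m)⁻¹ = ((L : ℝ) ^ i.1.k)⁻¹ * ((L : ℝ) ^ i.1.m)⁻¹ := rfl
  have hLk : (0 : ℝ) < (L : ℝ) ^ i.1.k := pow_pos hLr _
  have hLm : (0 : ℝ) < (L : ℝ) ^ i.1.m := pow_pos hLr _
  have hη' : 0 < (unitTorusGeo L i.1.k (TGIndex.Mn d hL i.1)).eta * ((unitTorusGeo L i.1.k (TGIndex.Mn d hL i.1)).L ^ i.1.m)⁻¹ := by rw [hηf]; positivity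
  have hη : 0 < (unitTorusGeo L i.1.k (TGIndex.Mn d hL i.1)).eta := by rw [hηc]; positivity
  have hη1 : (unitTorusGeo L i.1.k (TGIndex.Mn d hL i.1)).eta ≤ 1 := by rw [hηc]; exact inv_le_one_of_one_le₀ (one_le_pow₀ hLr1)
  have hηθ : (unitTorusGeo L i.1.k (TGIndex.Mn d hL i.1)).eta ≤ ((L : ℝ) ^ i.1.k) ^ (-γ) := by rw [hηc]; exact inv_pow_le_rpow hL1 i.1.k hγle1
  have hθ0 : 0 ≤ ((L : ℝ) ^ i.1.k) ^ (-γ) := Real.rpow_nonneg hLk.le _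
  have hN : (unitTorusGeo L i.1.k (TGIndex.Mn d hL i.1)).eta = ((L ^ i.1.m : ℕ) : ℝ) * ((unitTorusGeo L i.1.k (TGIndex.Mn d hL i.1)).eta * ((unitTorusGeo L i.1.k (TGIndex.Mn d hL i.1)).L ^ i.1.m)⁻¹) := by rw [hηf, hηc]; push_cast; field_simp
  have hn : (unitTorusGeo L i.1.k (TGIndex.Mn d hL i.1)).eta⁻¹ = ((L ^ i.1.k : ℕ) : ℝ) := by rw [hηc, inv_inv]; push_cast; ring
  have hn' : ((unitTorusGeo L i.1.k (TGIndex.Mn d hL i.1)).eta * ((unitTorusGeo L i.1.k (TGIndex.Mn d hL i.1)).L ^ i.1.m)⁻¹)⁻¹ = ((L ^ i.1.m * L ^ i.1.k : ℕ) : ℝ) := by rw [hηf, mul_inv, inv_inv, inv_inv]; push_cast; ring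
  -- `C_π·η′ ≤ 2(d+1)·θ`
  have hCθ : ((2 * ((d + 1) * (L ^ i.1.m - 1)) : ℕ) : ℝ) * ((unitTorusGeo L i.1.k (TGIndex.Mn d hL i.1)).eta * ((unitTorusGeo L i.1.k (TGIndex.Mn d hL i.1)).L ^ i.1.m)⁻¹) ≤ C₀ * ((L : ℝ) ^ i.1.k) ^ (-γ) := by
    have hθ' : ((L : ℝ) ^ i.1.k)⁻¹ ≤ ((L : ℝ) ^ i.1.k) ^ (-γ) := inv_pow_le_rpow hL1 i.1.k hγle1
    have hsub : (((L ^ i.1.m - 1 : ℕ)) : ℝ) ≤ (L : ℝ) ^ i.1.m := by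
      have h1 : 1 ≤ L ^ i.1.m := Nat.one_le_pow _ _ (by omega)
      rw [Nat.cast_sub h1]; push_cast; linarith
    have hcast : ((2 * ((d + 1) * (L ^ i.1.m - 1)) : ℕ) : ℝ) = 2 * ((d : ℝ) + 1) * (((L ^ i.1.m - 1 : ℕ)) : ℝ) := by push_cast; ring
    rw [hηf, hcast, hC₀]
    calc 2 * ((d : ℝ) + 1) * (((L ^ i.1.m - 1 : ℕ)) : ℝ) * (((L : ℝ) ^ i.1.k)⁻¹ * ((L : ℝ) ^ i.1.m)⁻¹)
        ≤ 2 * ((d : ℝ) + 1) * (L : ℝ) ^ i.1.m * (((L : ℝ) ^ i.1.k)⁻¹ * ((L : ℝ) ^ i.1.m)⁻¹) :=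
          mul_le_mul_of_nonneg_right (mul_le_mul_of_nonneg_left hsub (by positivity)) (by positivity)
      _ = 2 * ((d : ℝ) + 1) * ((L : ℝ) ^ i.1.k)⁻¹ := by field_simp
      _ ≤ 2 * ((d : ℝ) + 1) * ((L : ℝ) ^ i.1.k) ^ (-γ) := mul_le_mul_of_nonneg_left hθ' (by positivity)
  -- the window
  have hr0 : 0 ≤ c35 * (unitTorusGeo L i.1.k (TGIndex.Mn d hL i.1)).M * α₀ := by rw [hMeq]; positivity
  have hr2 : 2 * ((1 + Fintype.card (Fin (d + 1))) * ((3 + C₀) * (c35 * (unitTorusGeo L i.1.k (TGIndex.Mn d hL i.1)).M * α₀))) ≤ 1 := by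
    calc 2 * ((1 + Fintype.card (Fin (d + 1))) * ((3 + C₀) * (c35 * (unitTorusGeo L i.1.k (TGIndex.Mn d hL i.1)).M * α₀))) = (2 * ((1 + Fintype.card (Fin (d + 1))) * (3 + C₀))) * (c35 * (unitTorusGeo L i.1.k (TGIndex.Mn d hL i.1)).M * α₀) := by ring
      _ ≤ (2 * ((1 + Fintype.card (Fin (d + 1))) * (3 + C₀))) * r₀ := mul_le_mul_of_nonneg_left hwin hden.le
      _ = 1 := by rw [hr₀def]; exact mul_inv_cancel₀ hden.ne'
  have key := twoSidedLettersX_of_meanGauge e (ι := ι) (fun μ κ x => bshiftEquiv_comm (TGIndex.Mn d hL i.1) (L ^ i.1.m * L ^ i.1.k) μ κ x)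
    (fun f β hf => fibre_conn_kingPrV L i.1.k i.1.m (TGIndex.Mn d hL i.1) f β hf) (fun μ x' => kingPrV_bshiftEquiv_pow L i.1.k i.1.m (TGIndex.Mn d hL i.1) μ x') hη' hN hη hη1 hηθ hC₀0 hCθ hr0 hr2
    h1 h2' h3
  rw [hn, hn'] at key
  refine key.mono ?_ hθ0
  have hT : 0 ≤ 14 * Real.exp 1 * (1 + Fintype.card (Fin (d + 1))) * ((1 + Fintype.card (Fin (d + 1))) * (3 + C₀)) * (c35 * (unitTorusGeo L i.1.k (TGIndex.Mn d hL i.1)).M * α₀) := by positivity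
  calc 14 * Real.exp 1 * (1 + Fintype.card (Fin (d + 1))) * basisConst e * ((1 + Fintype.card (Fin (d + 1))) * ((3 + C₀) * (c35 * (unitTorusGeo L i.1.k (TGIndex.Mn d hL i.1)).M * α₀)))
      = 14 * Real.exp 1 * (1 + Fintype.card (Fin (d + 1))) * ((1 + Fintype.card (Fin (d + 1))) * (3 + C₀)) * (c35 * (unitTorusGeo L i.1.k (TGIndex.Mn d hL i.1)).M * α₀) * basisConst e := by ring
    _ ≤ 14 * Real.exp 1 * (1 + Fintype.card (Fin (d + 1))) * ((1 + Fintype.card (Fin (d + 1))) * (3 + C₀)) * (c35 * (unitTorusGeo L i.1.k (TGIndex.Mn d hL i.1)).M * α₀) * (basisConst e + 1) :=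
        mul_le_mul_of_nonneg_left (by linarith) hT
    _ = κ' * (c35 * (unitTorusGeo L i.1.k (TGIndex.Mn d hL i.1)).M * α₀) := by rw [hκ'def]; ring

/-- ★★★ **`T4EtaRate.NE2PlusOperator` BY NAME FOR BAŁABAN's FULL `U ≡ 1` PROPAGATOR ⊗ 1_𝔤 DRESSED BY HIS OWN `V′₁(A)` OF A LIVE GAUGE FIELD (fine coefficients from `A′`, coarse from the block
mean `Ā`), MODULO ONLY THE `U ≡ 1` ENTRY-2 η-DEFECT** — FILE 24 ★★★ `ne2PlusOperator_twoSided_of_letters` at the realised family: letters by FILE 26 ★★★ `twoSidedLettersX_of_meanGauge` (torus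
discharges: `bshiftEquiv_comm`, `fibre_conn_kingPrV`, `kingPrV_bshiftEquiv_pow`, `η = L^{−k} = L^m η′`, `C_πη′ ≤ 2(d+1)θ`, window `r₀ = (2(1+(d+1))(3+2(d+1)))⁻¹`, scale
`κ′ = 14e(1+(d+1))²(3+2(d+1))(κ_e+1)`), the shift-defect row letter by §2 on the coarse forward coefficients, every other `U ≡ 1` input from §2.
[cite: Balaban1985BackgroundPropagators, Thm 3.1 p.397 (quantifier template); (3.35)–(3.36) p.396, (3.42) p.397, (3.52) p.400, (3.63)–(3.65) p.402 (shapes, mechanism); King1986, p.664] -/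
theorem ne2PlusOperator_fullGM₂_v1X_of_entry2 (hLodd : Odd L) (hL2 : 2 ≤ L) (hL : Odd L ∧ 1 < L) {b : ℝ} (hb : 0 < b) (c35 : ℝ) (hc35 : 0 < c35)
    {γ : ℝ} (hγ0 : 0 < γ) (hγ1 : γ ≤ 1 / 16) {B₂ δ₂ : ℝ} (hB₂ : 0 ≤ B₂) (hδ₂ : 0 < δ₂)
    (h2 : ∀ (i : TGIndex) (ν : Fin (d + 1)),
      HasMaj (BlockNorm.ofBlocks (unitTorusGeo L i.k (TGIndex.Mn d hL i)) (blkFine L i.k (TGIndex.Mn d hL i)))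
        (BlockNorm.ofBlocks (unitTorusGeo L i.k (TGIndex.Mn d hL i)) (blkFine L i.k (TGIndex.Mn d hL i) ∘ kingPrV L i.k i.m (TGIndex.Mn d hL i)))
        (idef (pull (kingPrV L i.k i.m (TGIndex.Mn d hL i))) (pull (kingPrV L i.k i.m (TGIndex.Mn d hL i)))
          (gOp (TGIndex.Mn d hL i) (L ^ i.m * L ^ i.k) b ∘ₗ fgradAdj ((L ^ i.m * L ^ i.k : ℕ) : ℝ) (bshiftEquiv (TGIndex.Mn d hL i) (L ^ i.m * L ^ i.k) ν))
          (gOp (TGIndex.Mn d hL i) (L ^ i.k) b ∘ₗ fgradAdj ((L ^ i.k : ℕ) : ℝ) (bshiftEquiv (TGIndex.Mn d hL i) (L ^ i.k) ν)))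
        (fun y y' => B₂ * ((L : ℝ) ^ i.k) ^ (-γ) * Real.exp (-(δ₂ * tdistT (TGIndex.Mn d hL i) y y')))) :
    NE2PlusOperator c35 (fgInstanceV1G d 𝔄 ι hL) (fgFamilyV1X d 𝔄 ι e hL b) := by
  obtain ⟨δ, β, m₀, cT, mT, hδ, hδδ₂, hβ, hm₀, hBm, hcT, hmT, H⟩ := uniform_layer_fullGM₂R d ι hLodd hL2 hL hb hγ0 hγ1 hδ₂ hB₂
  have hL0 : L ≠ 0 := by omega
  have hL1 : 1 ≤ L := by omega
  have hLr : (0 : ℝ) < (L : ℝ) := by exact_mod_cast (show 0 < L by omega)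
  have hLr1 : (1 : ℝ) ≤ (L : ℝ) := by exact_mod_cast hL1
  have hγle1 : γ ≤ 1 := by linarith
  have hσ : 0 < δ / 12 := by positivity
  have hdJ : (Fintype.card (Fin (d + 1)) : ℝ) = (d : ℝ) + 1 := by rw [Fintype.card_fin]; push_cast; ring
  have hdJ0 : (0 : ℝ) ≤ Fintype.card (Fin (d + 1)) := Nat.cast_nonneg _
  have hDS : ∀ (i : TGIndex × Fin (d + 1)) (ν : Fin (d + 1)),
      HasMaj (BlockNorm.ofBlocks (unitTorusGeo L i.1.k (TGIndex.Mn d hL i.1)) (liftBlk (blkFine L i.1.k (TGIndex.Mn d hL i.1)) ι)) (BlockNorm.ofBlocks (unitTorusGeo L i.1.k (TGIndex.Mn d hL i.1)) (liftBlk (blkFine L i.1.k (TGIndex.Mn d hL i.1) ∘ kingPrV L i.1.k i.1.m (TGIndex.Mn d hL i.1)) ι))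
        (idef (pull (liftMap (kingPrV L i.1.k i.1.m (TGIndex.Mn d hL i.1)) ι)) (pull (liftMap (kingPrV L i.1.k i.1.m (TGIndex.Mn d hL i.1)) ι))
          (tensorId ι (gOp (TGIndex.Mn d hL i.1) (L ^ i.1.m * L ^ i.1.k) b) ∘ₗ fgradAdj ((L ^ i.1.m * L ^ i.1.k : ℕ) : ℝ) (liftEquiv (bshiftEquiv (TGIndex.Mn d hL i.1) (L ^ i.1.m * L ^ i.1.k) ν) ι))
          (tensorId ι (gOp (TGIndex.Mn d hL i.1) (L ^ i.1.k) b) ∘ₗ fgradAdj ((L ^ i.1.k : ℕ) : ℝ) (liftEquiv (bshiftEquiv (TGIndex.Mn d hL i.1) (L ^ i.1.k) ν) ι)))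
        (fun y y' => m₀ * ((L : ℝ) ^ i.1.k) ^ (-γ) * Real.exp (-(δ * (unitTorusGeo L i.1.k (TGIndex.Mn d hL i.1)).dist y y'))) := fun i ν => by
    rw [idef_comp_fgradAdj_liftEquiv]
    exact hasMaj_tensorId ι (fun _ _ => mul_nonneg (mul_nonneg hm₀.le (Real.rpow_nonneg (pow_nonneg hLr.le _) _)) (Real.exp_nonneg _))
      ((h2 i.1 ν).mono fun y y' => le_rate hB₂ hBm (one_le_pow₀ hLr1) le_rfl hδδ₂ (tdistT_nonneg _ _ _))
  -- the constants of the gauge letters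
  set C₀ : ℝ := 2 * ((d : ℝ) + 1) with hC₀
  have hC₀0 : 0 ≤ C₀ := by positivity
  set κ' : ℝ := 14 * Real.exp 1 * (1 + Fintype.card (Fin (d + 1))) * ((1 + Fintype.card (Fin (d + 1))) * (3 + C₀)) * (basisConst e + 1) with hκ'def
  have hκe := basisConst_nonneg e
  have hκ'pos : 0 < κ' := by positivity
  set r₀ : ℝ := (2 * ((1 + Fintype.card (Fin (d + 1))) * (3 + C₀)))⁻¹ with hr₀def
  have hden : 0 < 2 * ((1 + Fintype.card (Fin (d + 1))) * (3 + C₀)) := by positivity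
  have hr₀ : 0 < r₀ := inv_pos.2 hden
  -- the fifteen letters at every index, for every regular gauge field in the window
  have hLT : ∀ (i : TGIndex × Fin (d + 1)) (A' : Fin (d + 1) → Tor (fine (L ^ i.1.m * L ^ i.1.k) (TGIndex.Mn d hL i.1)) × Fin (d + 1) → 𝔄) (α₀ : ℝ),
      (v1GaugeBg 𝔄 (Fin (d + 1)) (fun μ => bshiftEquiv (TGIndex.Mn d hL i.1) (L ^ i.1.m * L ^ i.1.k) μ) ((unitTorusGeo L i.1.k (TGIndex.Mn d hL i.1)).eta * ((unitTorusGeo L i.1.k (TGIndex.Mn d hL i.1)).L ^ i.1.m)⁻¹) (unitTorusGeo L i.1.k (TGIndex.Mn d hL i.1)).M).Reg335 c35 α₀ A' → 0 < α₀ → 1 ≤ (unitTorusGeo L i.1.k (TGIndex.Mn d hL i.1)).M →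
      c35 * (unitTorusGeo L i.1.k (TGIndex.Mn d hL i.1)).M * α₀ ≤ r₀ →
      TwoSidedLetters (Fin (d + 1)) ι (kingPrV L i.1.k i.1.m (TGIndex.Mn d hL i.1)) (fun μ => bshiftEquiv (TGIndex.Mn d hL i.1) (L ^ i.1.k) μ) (fun μ => bshiftEquiv (TGIndex.Mn d hL i.1) (L ^ i.1.m * L ^ i.1.k) μ) ((L ^ i.1.k : ℕ) : ℝ)
        ((L ^ i.1.m * L ^ i.1.k : ℕ) : ℝ) (κ' * (c35 * (unitTorusGeo L i.1.k (TGIndex.Mn d hL i.1)).M * α₀)) (((L : ℝ) ^ i.1.k) ^ (-γ))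
        (v1cfgFX 𝔄 ι e (fun μ => bshiftEquiv (TGIndex.Mn d hL i.1) (L ^ i.1.m * L ^ i.1.k) μ) ((unitTorusGeo L i.1.k (TGIndex.Mn d hL i.1)).eta * ((unitTorusGeo L i.1.k (TGIndex.Mn d hL i.1)).L ^ i.1.m)⁻¹) A')
        (v1cfgCX 𝔄 ι e (kingPrV L i.1.k i.1.m (TGIndex.Mn d hL i.1)) (fun μ => bshiftEquiv (TGIndex.Mn d hL i.1) (L ^ i.1.k) μ) (unitTorusGeo L i.1.k (TGIndex.Mn d hL i.1)).eta A') :=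
    fun i A' α₀ hreg hα₀ hM hwin => twoSidedLettersX_torus d 𝔄 ι e hL hL2 hγle1 hc35 i A' α₀ hreg hα₀ hM hwin
  refine ne2PlusOperator_twoSided_of_letters (I := TGIndex × Fin (d + 1)) (J := Fin (d + 1)) (ι := ι) (fun i => (unitTorusGeo L i.1.k (TGIndex.Mn d hL i.1)))
    (fun i => Tor (fine (L ^ i.1.k) (TGIndex.Mn d hL i.1)) × Fin (d + 1)) (fun i => Tor (fine (L ^ i.1.m * L ^ i.1.k) (TGIndex.Mn d hL i.1)) × Fin (d + 1))
    (fun i => blkFine L i.1.k (TGIndex.Mn d hL i.1)) (fun i => kingPrV L i.1.k i.1.m (TGIndex.Mn d hL i.1)) (fun i μ => bshiftEquiv (TGIndex.Mn d hL i.1) (L ^ i.1.k) μ) (fun i μ => bshiftEquiv (TGIndex.Mn d hL i.1) (L ^ i.1.m * L ^ i.1.k) μ)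
    (fun i => ((L ^ i.1.k : ℕ) : ℝ)) (fun i => ((L ^ i.1.m * L ^ i.1.k : ℕ) : ℝ)) (fun i => i.1.m)
    (fun i => v1GaugeBg 𝔄 (Fin (d + 1)) (fun μ => bshiftEquiv (TGIndex.Mn d hL i.1) (L ^ i.1.k) μ) (unitTorusGeo L i.1.k (TGIndex.Mn d hL i.1)).eta (unitTorusGeo L i.1.k (TGIndex.Mn d hL i.1)).M)
    (fun i => v1GaugeBg 𝔄 (Fin (d + 1)) (fun μ => bshiftEquiv (TGIndex.Mn d hL i.1) (L ^ i.1.m * L ^ i.1.k) μ) ((unitTorusGeo L i.1.k (TGIndex.Mn d hL i.1)).eta * ((unitTorusGeo L i.1.k (TGIndex.Mn d hL i.1)).L ^ i.1.m)⁻¹) (unitTorusGeo L i.1.k (TGIndex.Mn d hL i.1)).M)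
    (fun i => v1GaugePairing 𝔄 (Fin (d + 1)) ι (g := (unitTorusGeo L i.1.k (TGIndex.Mn d hL i.1))) (blkFine L i.1.k (TGIndex.Mn d hL i.1)) (kingPrV L i.1.k i.1.m (TGIndex.Mn d hL i.1)) (fun μ => bshiftEquiv (TGIndex.Mn d hL i.1) (L ^ i.1.k) μ)
      (fun μ => bshiftEquiv (TGIndex.Mn d hL i.1) (L ^ i.1.m * L ^ i.1.k) μ) i.1.m (Nat.cast_ne_zero.mpr (NeZero.ne L)))
    (fun i => v1cfgFX 𝔄 ι e (fun μ => bshiftEquiv (TGIndex.Mn d hL i.1) (L ^ i.1.m * L ^ i.1.k) μ) ((unitTorusGeo L i.1.k (TGIndex.Mn d hL i.1)).eta * ((unitTorusGeo L i.1.k (TGIndex.Mn d hL i.1)).L ^ i.1.m)⁻¹))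
    (fun i => v1cfgCX 𝔄 ι e (kingPrV L i.1.k i.1.m (TGIndex.Mn d hL i.1)) (fun μ => bshiftEquiv (TGIndex.Mn d hL i.1) (L ^ i.1.k) μ) (unitTorusGeo L i.1.k (TGIndex.Mn d hL i.1)).eta)
    (fun i => ((L : ℝ) ^ i.1.k) ^ (-γ)) (fun i => i.2)
    (fun i => tensorId ι (gOp (TGIndex.Mn d hL i.1) (L ^ i.1.k) b))
    (fun i => tensorId ι (symbOp (TGIndex.Mn d hL i.1) (L ^ i.1.k) (sLap (TGIndex.Mn d hL i.1) (L ^ i.1.k) ((L ^ i.1.k : ℕ) : ℝ)) ∘ₗ gOp (TGIndex.Mn d hL i.1) (L ^ i.1.k) b))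
    (fun i => dPiecesM₂ d ι (TGIndex.Mn d hL i.1) (L ^ i.1.k) b)
    (fun i => tensorId ι (gOp (TGIndex.Mn d hL i.1) (L ^ i.1.m * L ^ i.1.k) b))
    (fun i => tensorId ι (symbOp (TGIndex.Mn d hL i.1) (L ^ i.1.m * L ^ i.1.k) (sLap (TGIndex.Mn d hL i.1) (L ^ i.1.m * L ^ i.1.k) ((L ^ i.1.m * L ^ i.1.k : ℕ) : ℝ)) ∘ₗ gOp (TGIndex.Mn d hL i.1) (L ^ i.1.m * L ^ i.1.k) b))
    (fun i => dPiecesM₂ d ι (TGIndex.Mn d hL i.1) (L ^ i.1.m * L ^ i.1.k) b)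
    c35 κ' r₀ hc35 hκ'pos hr₀ (fun i => triangle254_unitTorusGeo L i.1.k (TGIndex.Mn d hL i.1)) (fun i a c => tdistT_nonneg _ _ _) (fun i y => tdistT_self _ y) hσ.le
    (B4Sect5Proof.latticeConst_nonneg (d + 1) hσ.le) (fun i => rowSum_unitTorusGeo L i.1.k (TGIndex.Mn d hL i.1) hσ)
    (fun i => inv_pos.mpr (pow_pos hLr _)) (fun i => hLr) (fun i y => (unitTorusGeo_len L i.1.k (TGIndex.Mn d hL i.1) hL0 y).symm.le)
    (by linarith) hβ.le hm₀.le hγ0 (fun i => Real.rpow_nonneg (pow_nonneg hLr.le _) _) (fun i y => le_rfl) hcT.le hmT.le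
    (fun i => (H i).1) (fun i => (H i).2.1) (fun i => (H i).2.2.1) (fun i => (H i).2.2.2.1) (fun i => (H i).2.2.2.2.1) (fun i => (H i).2.2.2.2.2.1)
    (fun i => (H i).2.2.2.2.2.2.1) (fun i => (H i).2.2.2.2.2.2.2.1) (fun i => (H i).2.2.2.2.2.2.2.2.1) (fun i => (H i).2.2.2.2.2.2.2.2.2.1)
    (fun i ν => hDS i ν) (fun i => (H i).2.2.2.2.2.2.2.2.2.2.1) (fun i => (H i).2.2.2.2.2.2.2.2.2.2.2.1)
    (fun i U α₀ hreg hα₀ hM hwin => hLT i U α₀ hreg hα₀ hM hwin) (fun i U α₀ hreg hα₀ hM hwin μ => ?_)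
  -- the shift-defect row letter on the coarse forward coefficients: §2's generic conjunct with the letters 2 and 13 of the bundle
  obtain ⟨-, hA, -, -, -, -, -, -, -, -, -, -, hosc, -, -⟩ := hLT i U α₀ hreg hα₀ hM hwin
  exact (H i).2.2.2.2.2.2.2.2.2.2.2.2 (v1cfgCX 𝔄 ι e (kingPrV L i.1.k i.1.m (TGIndex.Mn d hL i.1)) (fun μ => bshiftEquiv (TGIndex.Mn d hL i.1) (L ^ i.1.k) μ) (unitTorusGeo L i.1.k (TGIndex.Mn d hL i.1)).eta U).2 _
    (mul_nonneg hκ'pos.le (mul_nonneg (mul_nonneg hc35.le (zero_le_one.trans hM)) hα₀.le)) (fun μ x i' => hA (Sum.inl μ) x i') hosc μ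

/-- ★★★ **`T4EtaRate.NE2PlusOperator` BY NAME, NO DISPLAYED BINDER: Bałaban's FULL `U ≡ 1` Landau-gauge propagator ⊗ 1_𝔤 on the torus family of record, dressed by HIS OWN FIRST-ORDER SPECIES
`V′₁(A)` (3.52) OF A LIVE GAUGE FIELD `A′` — `c = ad_{∇*A} + Σ_μ[F′(ad A⁺_μ) + F′(ad A⁻_μ)]`, `a^±_μ = ad A^±_μ ± ηF′(ad A^±_μ)` in coordinates `e : 𝔄 ≃ ℝ^ι`, fine coefficients from `A′`, COARSE
coefficients from the BLOCK MEAN `Ā = gavgM pr_V A′`, BOTH bond orientations, all four (3.42) entries CONSTRUCTED (entry 2 by parts), rate exponent `γ = 1∕(8(d+1))` (`d ≥ 1`)** — fed with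
dag-n15-a's ENTRY 2 (part 71).  Every input is a tree theorem; NO (3.44) mixed letter.  MODEL-LEVEL in the species (unit-scale C² reading of (3.35)–(3.36), `U ≡ 1` transports inside `V′₁`,
block-mean transport), GENUINE in the propagator. [cite: Balaban1985BackgroundPropagators, Thm 3.1 p.397 (quantifier template); (3.35)–(3.36) p.396, (3.42) p.397, (3.52) p.400, (3.63)–(3.65) p.402 (shapes, mechanism); Balaban1984PropagatorsI, Prop. 1.2 (1.110)–(1.111) p.35; Balaban1984PropagatorsII, (2.156) p.250; King1986, p.664] -/
theorem ne2PlusOperator_fullGM₂_v1X (hd1 : 1 ≤ d) (hLodd : Odd L) (hL2 : 2 ≤ L) (hL : Odd L ∧ 1 < L) {b : ℝ} (hb : 0 < b) (c35 : ℝ) (hc35 : 0 < c35) :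
    NE2PlusOperator c35 (fgInstanceV1G d 𝔄 ι hL) (fgFamilyV1X d 𝔄 ι e hL b) := by
  obtain ⟨δ₂, B₂, hδ₂, hB₂, H2⟩ := hasMaj_twoGridDefect_div (d := d) hLodd hL2 hb
  have hd1' : (1 : ℝ) ≤ (d : ℝ) := by exact_mod_cast hd1
  have hγ0 : 0 < 1 / (8 * ((d : ℝ) + 1)) := by positivity
  have hγ1 : 1 / (8 * ((d : ℝ) + 1)) ≤ 1 / 16 := one_div_le_one_div_of_le (by norm_num) (by nlinarith)
  refine ne2PlusOperator_fullGM₂_v1X_of_entry2 d 𝔄 ι e hLodd hL2 hL hb c35 hc35 hγ0 hγ1 hB₂.le hδ₂ fun i ν => ?_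
  have h := H2 i.mT i.k i.m i.one_le hL ν
  rw [← symbOp_sTinv_sub_one_eq, ← symbOp_sTinv_sub_one_eq, blkFine_comp_kingPrV]
  refine h.mono fun y y' => le_of_eq ?_
  rw [show ((L ^ i.k : ℕ) : ℝ) = (L : ℝ) ^ i.k by push_cast; ring]
  exact rfl

/-- The four-dimensional gauge-dressed instance (`d + 1 = 4`, `γ = 1∕32`). [cite: Balaban1985BackgroundPropagators, Thm 3.1 p.397 (quantifier template)] -/
theorem ne2PlusOperator_fullGM₂_v1X_dim4 (hLodd : Odd L) (hL2 : 2 ≤ L) (hL : Odd L ∧ 1 < L) {b : ℝ} (hb : 0 < b) (c35 : ℝ) (hc35 : 0 < c35) :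
    NE2PlusOperator c35 (fgInstanceV1G 3 𝔄 ι hL) (fgFamilyV1X 3 𝔄 ι e hL b) :=
  ne2PlusOperator_fullGM₂_v1X 3 𝔄 ι e (by norm_num) hLodd hL2 hL hb c35 hc35

end Node

end Summit.QuantumFields.YangMills.BalabanUVNodes.N15.BackgroundLayer

end

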